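import Mathlib.MeasureTheory.Measure.Lebesgue.EqHaar
import Mathlib.MeasureTheory.Measure.Haar.InnerProductSpace
import Mathlib.Analysis.InnerProductSpace.PiL2
import Mathlib.Analysis.Complex.Exponential
import Mathlib.LinearAlgebra.Basis.SMul
import Mathlib.LinearAlgebra.Basis.Submodule
import Literature.Algebra.EuclideanLattices.LatticePointCounting
import HarnessLib

/-!
# Lattice points in a convex body containing a ball (Micciancio–Goldwasser 2002, Prop. 8.7; Regev 2004, Claim 3.8)

Topic `Literature/Algebra/EuclideanLattices` (geometry of numbers). Everything in this file is
PROVED (theorems only, no named fact); it is groundwork for the named fact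
`Literature.Algebra.EuclideanLattices.usvp_of_dihedralCoset` (Regev 2004, Thm. 1.1), whose §3.3
("an improved algorithm", balls instead of cubes) rests on the following counting principle.

Let `Λ = span_ℤ b` be a full lattice in a finite-dimensional real normed space `E` (Haar measure `μ`,
`n = dim E`, `P` the half-open fundamental parallelepiped of `b`) whose cells `ℓ + P` are small:
`‖x - ⌊x⌋_b‖ ≤ ρ` for all `x` (a *cell radius* `ρ`).  For a bounded set `S`:

* `card_mul_measureReal_le_measureReal_add_closedBall`: `#(S ∩ Λ) · μ(P) ≤ μ(S + B̄(0, ρ))` — the cells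
  of the lattice points of `S` lie in the outer parallel body;
* `measureReal_setOf_closedBall_subset_le_card_mul`: `μ{y | B̄(y, ρ) ⊆ S} ≤ #(S ∩ Λ) · μ(P)` — the inner
  parallel body is covered by these cells;

and for `S` CONVEX containing a ball `B̄(c, r)`, the parallel bodies are sandwiched by homothetic
copies, `S + B̄(0, ρ) ⊆ c + (1 + ρ/r)(S − c)` and `c + (1 − ρ/r)(S − c) ⊆ {y | B̄(y, ρ) ⊆ S}`
(`add_closedBall_subset_image_homothety`, `image_homothety_subset_setOf_closedBall_subset`), whence

  `(1 − ρ/r)ⁿ μ(S) ≤ #(S ∩ Λ) · μ(P) ≤ (1 + ρ/r)ⁿ μ(S)`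

(`pow_mul_measureReal_le_card_mul`, `card_mul_le_pow_mul_measureReal`) and the linearised form
`|#(S ∩ Λ) μ(P)/μ(S) − 1| ≤ 2nρ/r` for `nρ ≤ r` (`abs_card_mul_div_sub_one_le`).  For the scaled
integer grid `(1/L)ℤⁿ ⊆ ℝⁿ` (`scaledGrid`, basis `gridBasis`, cell radius `√n/L`, `μ(P) = L⁻ⁿ`) this is
exactly Regev's Claim 3.8 = the special case of Micciancio–Goldwasser's Prop. 8.7 he quotes:
for a convex body `Q ⊇ B̄(c, r)` with `r ≥ n^{1.5}/L`,

  `| #((1/L)ℤⁿ ∩ Q) / (Lⁿ vol Q) − 1 | ≤ 2 n^{1.5} / (r L)`     (`abs_card_scaledGrid_div_sub_one_le`).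

(Regev prints the strict inequality `<`; we prove `≤`, which is what is used.  Micciancio–Goldwasser
state the two-sided sandwich for general lattices with the covering radius in place of `ρ`; the
cell radius of a basis bounds the covering radius, and for `(1/L)ℤⁿ` both proofs use `√n/L`.)

## References

* O. Regev, *Quantum computation and lattice problems*, SIAM J. Comput. 33 (2004) 738–760,
  §3.3, Claim 3.8 (p. 10 of the journal version) [Regev2004].
* D. Micciancio, S. Goldwasser, *Complexity of Lattice Problems: A Cryptographic Perspective*,
  Kluwer 2002, Ch. 8, Prop. 8.7 (counting lattice points in convex bodies containing a ball by
  inner/outer parallel bodies).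
* D. A. Marcus, *Number Fields*, 2nd ed., Springer 2018, Ch. 6, proof of Lemma 2 (the cell tiling,
  vendored in `LatticePointCounting.lean`) [Marcus2018].
-/

noncomputable section

open MeasureTheory Module Submodule Bornology Set Metric ZSpan
open scoped Pointwise ENNReal

namespace Literature.Algebra.EuclideanLattices

/-! ## Cells versus parallel bodies -/

section General

variable {E : Type*} [NormedAddCommGroup E] [NormedSpace ℝ E]
variable {ι : Type*} [Fintype ι] (b : Basis ι ℝ E)

/-- The cell radius `R_b = ∑ ‖b i‖` of `LatticePointCounting.lean` is a cell radius in the sense used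
here: `‖x - ⌊x⌋_b‖ ≤ R_b`. [folklore] -/
theorem norm_sub_floor_le_cellRadius (x : E) : ‖x - (floor b x : E)‖ ≤ cellRadius b :=
  norm_sub_le_of_mem_cell b (mem_cell_floor b x)

/-- The cells of lattice points of `S` lie in the outer parallel body `S + B̄(0, ρ)`.
[cite: Regev2004, Claim 3.8 (proof = Micciancio–Goldwasser 2002, Prop. 8.7)] -/
theorem biUnion_cell_subset_add_closedBall {ρ : ℝ} (hρ : ∀ x : E, ‖x - (floor b x : E)‖ ≤ ρ)
    {S : Set E} {T : Finset E} (hT : ∀ ℓ ∈ T, ℓ ∈ S) :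
    (⋃ ℓ ∈ T, cell b ℓ) ⊆ S + closedBall (0 : E) ρ := by
  intro x hx
  simp only [mem_iUnion, exists_prop] at hx
  obtain ⟨ℓ, hℓT, hx⟩ := hx
  rw [mem_cell] at hx
  refine Set.mem_add.2 ⟨ℓ, hT ℓ hℓT, x - ℓ, ?_, add_sub_cancel ℓ x⟩
  rw [mem_closedBall, dist_zero_right, ← hx]
  exact hρ x

/-- The inner parallel body `{y | B̄(y, ρ) ⊆ S}` is covered by the cells of the lattice points of `S`:
the floor of such a `y` is within `ρ` of `y`, hence in `S`.
[cite: Regev2004, Claim 3.8 (proof = Micciancio–Goldwasser 2002, Prop. 8.7)] -/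
theorem setOf_closedBall_subset_subset_biUnion_cell {ρ : ℝ}
    (hρ : ∀ x : E, ‖x - (floor b x : E)‖ ≤ ρ) {S : Set E} {T : Finset E}
    (hT : ∀ ℓ ∈ span ℤ (Set.range b), ℓ ∈ S → ℓ ∈ T) :
    {y : E | closedBall y ρ ⊆ S} ⊆ ⋃ ℓ ∈ T, cell b ℓ := by
  intro y hy
  have hℓΛ : (floor b y : E) ∈ span ℤ (Set.range b) := (floor b y).2
  have hℓS : (floor b y : E) ∈ S := by
    refine hy ?_
    rw [mem_closedBall, dist_comm, dist_eq_norm]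
    exact hρ y
  simp only [mem_iUnion, exists_prop]
  exact ⟨_, hT _ hℓΛ hℓS, mem_cell_floor b y⟩

/-- **Outer homothety.** If `S` is convex and contains the ball `B̄(c, r)`, `r > 0`, then
`S + B̄(0, ρ) ⊆ c + (1 + ρ/r)(S − c)`: for `q ∈ S`, `‖v‖ ≤ ρ`, the point `q + v` is the image under
the homothety of ratio `1 + ρ/r` of the convex combination
`(r/(r+ρ)) q + (ρ/(r+ρ)) (c + (r/ρ) v)` of two points of `S`.
[cite: Regev2004, Claim 3.8 (proof = Micciancio–Goldwasser 2002, Prop. 8.7)] -/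
theorem add_closedBall_subset_image_homothety {S : Set E} (hS : Convex ℝ S) {c : E} {r ρ : ℝ}
    (hr : 0 < r) (hρ : 0 ≤ ρ) (hball : closedBall c r ⊆ S) :
    S + closedBall (0 : E) ρ ⊆ AffineMap.homothety c (1 + ρ / r) '' S := by
  rintro _ ⟨q, hq, v, hv, rfl⟩
  rw [mem_closedBall, dist_zero_right] at hv
  rcases hρ.eq_or_lt with rfl | hρ'
  · have hv0 : v = 0 := norm_le_zero_iff.1 hv
    subst hv0
    refine ⟨q, hq, ?_⟩
    simp
  · set w : E := c + (r / ρ) • v with hw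
    have hwS : w ∈ S := by
      refine hball ?_
      rw [mem_closedBall, dist_eq_norm, hw, add_sub_cancel_left, norm_smul,
        Real.norm_of_nonneg (by positivity)]
      calc r / ρ * ‖v‖ ≤ r / ρ * ρ := by gcongr
        _ = r := by field_simp
    set a : ℝ := r / (r + ρ) with ha
    set a' : ℝ := ρ / (r + ρ) with ha'
    have ha0 : 0 ≤ a := by positivity
    have ha'0 : 0 ≤ a' := by positivity
    have haa' : a + a' = 1 := by rw [ha, ha']; field_simp
    have hq'S : a • q + a' • w ∈ S := hS hq hwS ha0 ha'0 haa'
    refine ⟨a • q + a' • w, hq'S, ?_⟩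
    set t : ℝ := 1 + ρ / r with ht
    have hta : t * a = 1 := by rw [ht, ha]; field_simp
    have htb : t * a' * (r / ρ) = 1 := by rw [ht, ha']; field_simp
    have htc : t * a' - t + 1 = 0 := by rw [ht, ha']; field_simp; ring
    simp only [AffineMap.homothety_apply, vsub_eq_sub, vadd_eq_add]
    calc t • (a • q + a' • w - c) + c
        = (t * a) • q + (t * a' * (r / ρ)) • v + (t * a' - t + 1) • c := by
          rw [hw]; module
      _ = q + v := by rw [hta, htb, htc]; simp

/-- **Inner homothety.** If `S` is convex and contains the ball `B̄(c, r)`, `0 ≤ ρ ≤ r`, `0 < r`, then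
every point of `c + (1 − ρ/r)(S − c)` has its `ρ`-ball inside `S`: for `q ∈ S` and `‖v‖ ≤ ρ`,
`(c + (1 − ρ/r)(q − c)) + v = (1 − ρ/r) q + (ρ/r)(c + (r/ρ) v)` is a convex combination of points of
`S`. [cite: Regev2004, Claim 3.8 (proof = Micciancio–Goldwasser 2002, Prop. 8.7)] -/
theorem image_homothety_subset_setOf_closedBall_subset {S : Set E} (hS : Convex ℝ S) {c : E}
    {r ρ : ℝ} (hr : 0 < r) (hρ : 0 ≤ ρ) (hρr : ρ ≤ r) (hball : closedBall c r ⊆ S) :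
    AffineMap.homothety c (1 - ρ / r) '' S ⊆ {y : E | closedBall y ρ ⊆ S} := by
  rintro _ ⟨q, hq, rfl⟩ z hz
  rw [mem_closedBall, dist_eq_norm] at hz
  set y : E := AffineMap.homothety c (1 - ρ / r) q with hy
  set v : E := z - y with hv
  have hzv : z = y + v := by rw [hv]; abel
  rcases hρ.eq_or_lt with rfl | hρ'
  · have hv0 : v = 0 := norm_le_zero_iff.1 hz
    rw [hzv, hv0, add_zero, hy]
    simpa [AffineMap.homothety_apply] using hq
  · set w : E := c + (r / ρ) • v with hw
    have hwS : w ∈ S := by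
      refine hball ?_
      rw [mem_closedBall, dist_eq_norm, hw, add_sub_cancel_left, norm_smul,
        Real.norm_of_nonneg (by positivity)]
      calc r / ρ * ‖v‖ ≤ r / ρ * ρ := by gcongr
        _ = r := by field_simp
    have h1 : 0 ≤ 1 - ρ / r := sub_nonneg.2 ((div_le_one hr).2 hρr)
    have h2 : 0 ≤ ρ / r := by positivity
    have h3 : (1 - ρ / r) + ρ / r = 1 := by ring
    have hzS : (1 - ρ / r) • q + (ρ / r) • w ∈ S := hS hq hwS h1 h2 h3
    have hρr' : ρ / r * (r / ρ) = 1 := by field_simp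
    have : z = (1 - ρ / r) • q + (ρ / r) • w := by
      rw [hzv, hy, hw]
      simp only [AffineMap.homothety_apply, vsub_eq_sub, vadd_eq_add]
      calc (1 - ρ / r) • (q - c) + c + v
          = (1 - ρ / r) • q + (ρ / r) • c + (1 : ℝ) • v := by module
        _ = (1 - ρ / r) • q + (ρ / r) • c + (ρ / r * (r / ρ)) • v := by rw [hρr']
        _ = (1 - ρ / r) • q + (ρ / r) • (c + (r / ρ) • v) := by module
    rw [this]
    exact hzS

omit [NormedSpace ℝ E] in
/-- The inner parallel body lies inside `S` (take the centre of the ball), for `ρ ≥ 0`. [folklore] -/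
theorem setOf_closedBall_subset_subset {S : Set E} {ρ : ℝ} (hρ : 0 ≤ ρ) :
    {y : E | closedBall y ρ ⊆ S} ⊆ S := fun _ hy => hy (mem_closedBall_self hρ)

variable [MeasurableSpace E] [BorelSpace E] (μ : Measure E) [μ.IsAddHaarMeasure]
variable [FiniteDimensional ℝ E]

/-- **Upper count.** For a bounded set `S` and a lattice with cell radius `ρ`:
`#(S ∩ Λ) · μ(P) ≤ μ(S + B̄(0, ρ))`.
[cite: Regev2004, Claim 3.8 (proof = Micciancio–Goldwasser 2002, Prop. 8.7)] -/
theorem card_mul_measureReal_le_measureReal_add_closedBall {ρ : ℝ}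
    (hρ : ∀ x : E, ‖x - (floor b x : E)‖ ≤ ρ) {S : Set E} (hS : IsBounded S) :
    (Nat.card (S ∩ (span ℤ (Set.range b) : Set E) : Set E) : ℝ) * μ.real (fundamentalDomain b) ≤
      μ.real (S + closedBall (0 : E) ρ) := by
  classical
  have hfin := setFinite_inter b hS
  set T : Finset E := hfin.toFinset with hTdef
  have hTmem : ∀ ℓ, ℓ ∈ T ↔ ℓ ∈ S ∧ ℓ ∈ span ℤ (Set.range b) := fun ℓ ↦ by
    rw [hTdef, Set.Finite.mem_toFinset]; rfl
  have hcardT : Nat.card (S ∩ (span ℤ (Set.range b) : Set E) : Set E) = T.card := by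
    rw [hTdef, Nat.card_eq_card_finite_toFinset hfin]
  have hμA : μ (⋃ ℓ ∈ T, cell b ℓ) = T.card * μ (fundamentalDomain b) :=
    measure_biUnion_cell b μ fun ℓ hℓ ↦ ((hTmem ℓ).1 hℓ).2
  have hsub := biUnion_cell_subset_add_closedBall b hρ (S := S) (T := T)
    fun ℓ hℓ ↦ ((hTmem ℓ).1 hℓ).1
  have htop : μ (S + closedBall (0 : E) ρ) ≠ ⊤ := (hS.add isBounded_closedBall).measure_lt_top.ne
  have h1 : (T.card : ℝ≥0∞) * μ (fundamentalDomain b) ≤ μ (S + closedBall (0 : E) ρ) :=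
    hμA ▸ measure_mono hsub
  have h2 := ENNReal.toReal_mono htop h1
  rw [ENNReal.toReal_mul, ENNReal.toReal_natCast] at h2
  rw [hcardT]
  simpa [measureReal_def] using h2

/-- **Lower count.** For a bounded set `S` and a lattice with cell radius `ρ`:
`μ{y | B̄(y, ρ) ⊆ S} ≤ #(S ∩ Λ) · μ(P)`.
[cite: Regev2004, Claim 3.8 (proof = Micciancio–Goldwasser 2002, Prop. 8.7)] -/
theorem measureReal_setOf_closedBall_subset_le_card_mul {ρ : ℝ}
    (hρ : ∀ x : E, ‖x - (floor b x : E)‖ ≤ ρ) {S : Set E} (hS : IsBounded S) :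
    μ.real {y : E | closedBall y ρ ⊆ S} ≤
      (Nat.card (S ∩ (span ℤ (Set.range b) : Set E) : Set E) : ℝ) * μ.real (fundamentalDomain b) := by
  classical
  have hfin := setFinite_inter b hS
  set T : Finset E := hfin.toFinset with hTdef
  have hTmem : ∀ ℓ, ℓ ∈ T ↔ ℓ ∈ S ∧ ℓ ∈ span ℤ (Set.range b) := fun ℓ ↦ by
    rw [hTdef, Set.Finite.mem_toFinset]; rfl
  have hcardT : Nat.card (S ∩ (span ℤ (Set.range b) : Set E) : Set E) = T.card := by
    rw [hTdef, Nat.card_eq_card_finite_toFinset hfin]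
  have hμA : μ (⋃ ℓ ∈ T, cell b ℓ) = T.card * μ (fundamentalDomain b) :=
    measure_biUnion_cell b μ fun ℓ hℓ ↦ ((hTmem ℓ).1 hℓ).2
  have hsub := setOf_closedBall_subset_subset_biUnion_cell b hρ (S := S) (T := T)
    fun ℓ hℓ hℓS ↦ (hTmem ℓ).2 ⟨hℓS, hℓ⟩
  have hPtop : μ (fundamentalDomain b) ≠ ⊤ := (measure_fundamentalDomain_lt_top b μ).ne
  have htop : (T.card : ℝ≥0∞) * μ (fundamentalDomain b) ≠ ⊤ := ENNReal.mul_ne_top (by simp) hPtop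
  have h1 : μ {y : E | closedBall y ρ ⊆ S} ≤ (T.card : ℝ≥0∞) * μ (fundamentalDomain b) :=
    hμA ▸ measure_mono hsub
  have h2 := ENNReal.toReal_mono htop h1
  rw [ENNReal.toReal_mul, ENNReal.toReal_natCast] at h2
  rw [hcardT]
  simpa [measureReal_def] using h2

/-- **Sandwich, upper half** (Micciancio–Goldwasser 2002, Prop. 8.7; Regev 2004, Claim 3.8): for a
bounded convex `S ⊇ B̄(c, r)` (`r > 0`) and a lattice with cell radius `ρ ≥ 0`,
`#(S ∩ Λ) · μ(P) ≤ (1 + ρ/r)ⁿ μ(S)`, `n = dim E`.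
[cite: Regev2004, Claim 3.8 (proof = Micciancio–Goldwasser 2002, Prop. 8.7)] -/
theorem card_mul_le_pow_mul_measureReal {ρ : ℝ} (hρ0 : 0 ≤ ρ)
    (hρ : ∀ x : E, ‖x - (floor b x : E)‖ ≤ ρ) {S : Set E} (hSc : Convex ℝ S) (hSb : IsBounded S)
    {c : E} {r : ℝ} (hr : 0 < r) (hball : closedBall c r ⊆ S) :
    (Nat.card (S ∩ (span ℤ (Set.range b) : Set E) : Set E) : ℝ) * μ.real (fundamentalDomain b) ≤
      (1 + ρ / r) ^ finrank ℝ E * μ.real S := by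
  have h1 := card_mul_measureReal_le_measureReal_add_closedBall b μ hρ hSb
  have hsub := add_closedBall_subset_image_homothety hSc hr hρ0 hball
  have hStop : μ S ≠ ⊤ := hSb.measure_lt_top.ne
  have himg : μ (AffineMap.homothety c (1 + ρ / r) '' S) =
      ENNReal.ofReal (|(1 + ρ / r) ^ finrank ℝ E|) * μ S :=
    Measure.addHaar_image_homothety μ c (1 + ρ / r) S
  have htop : μ (AffineMap.homothety c (1 + ρ / r) '' S) ≠ ⊤ := by
    rw [himg]; exact ENNReal.mul_ne_top ENNReal.ofReal_ne_top hStop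
  have h2 : μ.real (S + closedBall (0 : E) ρ) ≤ μ.real (AffineMap.homothety c (1 + ρ / r) '' S) :=
    measureReal_mono hsub htop
  have h3 : μ.real (AffineMap.homothety c (1 + ρ / r) '' S) = (1 + ρ / r) ^ finrank ℝ E * μ.real S := by
    rw [measureReal_def, himg, ENNReal.toReal_mul, ENNReal.toReal_ofReal (abs_nonneg _),
      abs_of_nonneg (by positivity), measureReal_def]
  linarith

/-- **Sandwich, lower half** (Micciancio–Goldwasser 2002, Prop. 8.7; Regev 2004, Claim 3.8): for a
bounded convex `S ⊇ B̄(c, r)` and a lattice with cell radius `0 ≤ ρ ≤ r`,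
`(1 − ρ/r)ⁿ μ(S) ≤ #(S ∩ Λ) · μ(P)`.
[cite: Regev2004, Claim 3.8 (proof = Micciancio–Goldwasser 2002, Prop. 8.7)] -/
theorem pow_mul_measureReal_le_card_mul {ρ : ℝ} (hρ0 : 0 ≤ ρ)
    (hρ : ∀ x : E, ‖x - (floor b x : E)‖ ≤ ρ) {S : Set E} (hSc : Convex ℝ S) (hSb : IsBounded S)
    {c : E} {r : ℝ} (hr : 0 < r) (hρr : ρ ≤ r) (hball : closedBall c r ⊆ S) :
    (1 - ρ / r) ^ finrank ℝ E * μ.real S ≤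
      (Nat.card (S ∩ (span ℤ (Set.range b) : Set E) : Set E) : ℝ) * μ.real (fundamentalDomain b) := by
  have h1 := measureReal_setOf_closedBall_subset_le_card_mul b μ hρ hSb
  have hsub := image_homothety_subset_setOf_closedBall_subset hSc hr hρ0 hρr hball
  have htop : μ {y : E | closedBall y ρ ⊆ S} ≠ ⊤ :=
    (hSb.subset (setOf_closedBall_subset_subset hρ0)).measure_lt_top.ne
  have h2 : μ.real (AffineMap.homothety c (1 - ρ / r) '' S) ≤ μ.real {y : E | closedBall y ρ ⊆ S} :=
    measureReal_mono hsub htop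
  have h3 : μ.real (AffineMap.homothety c (1 - ρ / r) '' S) = (1 - ρ / r) ^ finrank ℝ E * μ.real S := by
    rw [measureReal_def, Measure.addHaar_image_homothety, ENNReal.toReal_mul,
      ENNReal.toReal_ofReal (abs_nonneg _), abs_of_nonneg, measureReal_def]
    exact pow_nonneg (sub_nonneg.2 ((div_le_one hr).2 hρr)) _
  linarith

/-- `(1 + s)ⁿ ≤ 1 + 2ns` for `0 ≤ s` and `ns ≤ 1` (via `(1 + s)ⁿ ≤ exp (ns)` and
`exp t ≤ 1 + t + t² ≤ 1 + 2t` on `[0, 1]`). [folklore] -/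
theorem one_add_pow_le_one_add_two_mul {s : ℝ} (hs : 0 ≤ s) (n : ℕ) (hns : n * s ≤ 1) :
    (1 + s) ^ n ≤ 1 + 2 * (n * s) := by
  have h1 : (1 + s) ^ n ≤ Real.exp s ^ n :=
    pow_le_pow_left₀ (by positivity) (by linarith [Real.add_one_le_exp s]) n
  have h2 : Real.exp s ^ n = Real.exp (n * s) := by rw [← Real.exp_nat_mul]
  rw [h2] at h1
  have h3 := Real.abs_exp_sub_one_sub_id_le (x := n * s)
    (by rw [abs_of_nonneg (by positivity)]; exact hns)
  have h4 : Real.exp (n * s) - 1 - n * s ≤ (n * s) ^ 2 := (le_abs_self _).trans h3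
  have h5 : 0 ≤ (n : ℝ) * s := by positivity
  nlinarith

/-- **Linearised count** (the form printed by Regev): for a bounded convex `S ⊇ B̄(c, r)` and a
lattice with cell radius `ρ ≥ 0` such that `n ρ ≤ r` (`n = dim E`),
`| #(S ∩ Λ) μ(P) / μ(S) − 1 | ≤ 2 n ρ / r`.
[cite: Regev2004, Claim 3.8 (proof = Micciancio–Goldwasser 2002, Prop. 8.7)] -/
theorem abs_card_mul_div_sub_one_le {ρ : ℝ} (hρ0 : 0 ≤ ρ)
    (hρ : ∀ x : E, ‖x - (floor b x : E)‖ ≤ ρ) {S : Set E} (hSc : Convex ℝ S) (hSb : IsBounded S)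
    {c : E} {r : ℝ} (hr : 0 < r) (hρr : ρ ≤ r) (hball : closedBall c r ⊆ S)
    (hn : (finrank ℝ E : ℝ) * ρ ≤ r) :
    |(Nat.card (S ∩ (span ℤ (Set.range b) : Set E) : Set E) : ℝ) * μ.real (fundamentalDomain b) /
        μ.real S - 1| ≤ 2 * finrank ℝ E * ρ / r := by
  set n : ℕ := finrank ℝ E with hn'
  set N : ℝ := (Nat.card (S ∩ (span ℤ (Set.range b) : Set E) : Set E) : ℝ) *
    μ.real (fundamentalDomain b) with hN
  -- `μ(S) > 0`
  have hSpos : 0 < μ.real S := by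
    have h0 : 0 < μ.real (closedBall c r) := by
      rw [measureReal_def]
      exact ENNReal.toReal_pos (measure_closedBall_pos μ c hr).ne'
        isBounded_closedBall.measure_lt_top.ne
    exact h0.trans_le (measureReal_mono hball hSb.measure_lt_top.ne)
  have hup := card_mul_le_pow_mul_measureReal b μ hρ0 hρ hSc hSb hr hball
  have hlo := pow_mul_measureReal_le_card_mul b μ hρ0 hρ hSc hSb hr hρr hball
  set s : ℝ := ρ / r with hs
  have hs0 : 0 ≤ s := by positivity
  have hns : n * s ≤ 1 := by
    rw [hs, ← mul_div_assoc, div_le_one hr]; exact hn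
  have hupper : (1 + s) ^ n ≤ 1 + 2 * (n * s) := one_add_pow_le_one_add_two_mul hs0 n hns
  have hs1 : s ≤ 1 := by rw [hs, div_le_one hr]; exact hρr
  have hlower : 1 - n * s ≤ (1 - s) ^ n := by
    have h := one_add_mul_le_pow (a := -s) (by linarith) n
    have e1 : (1 : ℝ) + -s = 1 - s := by ring
    have e2 : (1 : ℝ) + n * -s = 1 - n * s := by ring
    rwa [e1, e2] at h
  have e1 : N / μ.real S ≤ (1 + s) ^ n := by
    rw [div_le_iff₀ hSpos]; exact hup
  have e2 : (1 - s) ^ n ≤ N / μ.real S := by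
    rw [le_div_iff₀ hSpos]; exact hlo
  have hgoal : 2 * (n : ℝ) * ρ / r = 2 * (n * s) := by rw [hs]; ring
  rw [hgoal, abs_le]
  constructor <;> nlinarith

end General

/-! ## The scaled integer grid `(1/L)ℤⁿ` -/

section Grid

variable (n : ℕ) {L : ℝ}

/-- The scaled integer grid `(1/L)ℤⁿ ⊆ ℝⁿ = EuclideanSpace ℝ (Fin n)`, as a set.
[cite: Regev2004, Claim 3.8] -/
def scaledGrid (L : ℝ) : Set (EuclideanSpace ℝ (Fin n)) :=
  {x | ∀ i, ∃ k : ℤ, x i = k / L}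

/-- Membership in the scaled grid, unfolded. [folklore] -/
theorem mem_scaledGrid {L : ℝ} {x : EuclideanSpace ℝ (Fin n)} :
    x ∈ scaledGrid n L ↔ ∀ i, ∃ k : ℤ, x i = k / L := Iff.rfl

/-- The basis `(1/L) e₀, …, (1/L) e_{n-1}` of `ℝⁿ` whose `ℤ`-span is `(1/L)ℤⁿ` (`L ≠ 0`).
[cite: Regev2004, Claim 3.8] -/
def gridBasis (hL : L ≠ 0) : Basis (Fin n) ℝ (EuclideanSpace ℝ (Fin n)) :=
  (EuclideanSpace.basisFun (Fin n) ℝ).toBasis.unitsSMul fun _ => Units.mk0 L⁻¹ (inv_ne_zero hL)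

/-- Coordinates in the grid basis: `repr x i = L · xᵢ`. [folklore] -/
theorem gridBasis_repr (hL : L ≠ 0) (x : EuclideanSpace ℝ (Fin n)) (i : Fin n) :
    (gridBasis n hL).repr x i = L * x i := by
  simp [gridBasis, Basis.repr_unitsSMul, Units.smul_def]

/-- The `ℤ`-span of the grid basis is the scaled grid `(1/L)ℤⁿ`. [folklore] -/
theorem coe_span_gridBasis (hL : L ≠ 0) :
    (span ℤ (Set.range (gridBasis n hL)) : Set (EuclideanSpace ℝ (Fin n))) = scaledGrid n L := by
  ext x
  rw [SetLike.mem_coe, Basis.mem_span_iff_repr_mem, mem_scaledGrid]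
  refine forall_congr' fun i => ?_
  rw [gridBasis_repr]
  constructor
  · rintro ⟨k, hk⟩
    refine ⟨k, ?_⟩
    rw [eq_div_iff hL, mul_comm]
    exact_mod_cast hk.symm
  · rintro ⟨k, hk⟩
    refine ⟨k, ?_⟩
    rw [hk]
    simp [mul_div_cancel₀ _ hL]

/-- The cells of the grid basis have radius `√n/|L|`: `‖x − ⌊x⌋‖ ≤ √n / |L|`. [folklore] -/
theorem norm_sub_floor_gridBasis_le (hL : L ≠ 0) (x : EuclideanSpace ℝ (Fin n)) :
    ‖x - (floor (gridBasis n hL) x : EuclideanSpace ℝ (Fin n))‖ ≤ Real.sqrt n / |L| := by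
  rw [← fract_apply]
  set y := fract (gridBasis n hL) x with hy
  have hcoord : ∀ i, |y i| ≤ 1 / |L| := fun i ↦ by
    have h1 : (gridBasis n hL).repr y i = Int.fract ((gridBasis n hL).repr x i) := by
      rw [hy, repr_fract_apply]
    rw [gridBasis_repr] at h1
    have h2 : y i = Int.fract ((gridBasis n hL).repr x i) / L := by
      rw [← h1]; field_simp
    rw [h2, abs_div]
    gcongr
    rw [abs_of_nonneg (Int.fract_nonneg _)]
    exact (Int.fract_lt_one _).le
  rw [EuclideanSpace.norm_eq]
  calc Real.sqrt (∑ i, ‖y i‖ ^ 2) ≤ Real.sqrt (∑ _i : Fin n, (1 / |L|) ^ 2) := by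
        gcongr with i
        rw [Real.norm_eq_abs]
        exact hcoord i
    _ = Real.sqrt n / |L| := by
        rw [Finset.sum_const, Finset.card_univ, Fintype.card_fin, nsmul_eq_mul,
          Real.sqrt_mul (Nat.cast_nonneg _), Real.sqrt_sq (by positivity), mul_one_div]

/-- The fundamental parallelepiped of the grid basis has volume `|L|⁻ⁿ`. [folklore] -/
theorem volume_real_fundamentalDomain_gridBasis (hL : L ≠ 0) :
    volume.real (fundamentalDomain (gridBasis n hL)) = (|L| ^ n)⁻¹ := by
  classical
  set b₀ := (EuclideanSpace.basisFun (Fin n) ℝ).toBasis with hb₀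
  have h1 : volume.real (fundamentalDomain (gridBasis n hL)) =
      |b₀.det (gridBasis n hL)| * volume.real (fundamentalDomain b₀) :=
    measureReal_fundamentalDomain _ volume b₀
  have h2 : b₀.det (gridBasis n hL) = ∏ _i : Fin n, L⁻¹ := by
    rw [gridBasis, hb₀, Basis.det_unitsSMul_self]; rfl
  have h3 : volume.real (fundamentalDomain b₀) = 1 := by
    rw [measureReal_congr (fundamentalDomain_ae_parallelepiped b₀ volume), measureReal_def, hb₀,
      OrthonormalBasis.coe_toBasis, OrthonormalBasis.volume_parallelepiped, ENNReal.toReal_one]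
  rw [h1, h2, h3, mul_one, Finset.prod_const, Finset.card_univ, Fintype.card_fin, abs_pow,
    abs_inv, inv_pow]

/-- **Regev 2004, Claim 3.8** (special case of Micciancio–Goldwasser 2002, Prop. 8.7).  Let
`L > 0` and let `Q ⊆ ℝⁿ` be a bounded convex set containing a ball of radius `r ≥ n^{1.5}/L`
(`r > 0`).  Then the number of points of the scaled grid `(1/L)ℤⁿ` in `Q` satisfies
`| #((1/L)ℤⁿ ∩ Q) / (Lⁿ vol Q) − 1 | ≤ 2 n^{1.5} / (r L)` (printed with `<`; `n^{1.5} = n√n`).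
[cite: Regev2004, Claim 3.8] -/
theorem abs_card_scaledGrid_div_sub_one_le (hL : 0 < L) {Q : Set (EuclideanSpace ℝ (Fin n))}
    (hQc : Convex ℝ Q) (hQb : IsBounded Q) {c : EuclideanSpace ℝ (Fin n)} {r : ℝ} (hr0 : 0 < r)
    (hball : closedBall c r ⊆ Q) (hr : n * Real.sqrt n / L ≤ r) :
    |(Nat.card (Q ∩ scaledGrid n L : Set (EuclideanSpace ℝ (Fin n))) : ℝ) / (L ^ n * volume.real Q)
        - 1| ≤ 2 * n * Real.sqrt n / (r * L) := by
  have hL0 : L ≠ 0 := hL.ne'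
  have hρ : ∀ x : EuclideanSpace ℝ (Fin n),
      ‖x - (floor (gridBasis n hL0) x : EuclideanSpace ℝ (Fin n))‖ ≤ Real.sqrt n / L := fun x ↦ by
    simpa [abs_of_pos hL] using norm_sub_floor_gridBasis_le n hL0 x
  have hρr : Real.sqrt n / L ≤ r := by
    rcases Nat.eq_zero_or_pos n with h | h
    · rw [h, Nat.cast_zero, Real.sqrt_zero, zero_div]; exact hr0.le
    · have h1 : (1 : ℝ) ≤ n := by exact_mod_cast h
      calc Real.sqrt n / L ≤ n * Real.sqrt n / L := by
            rw [mul_div_assoc]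
            exact le_mul_of_one_le_left (by positivity) h1
        _ ≤ r := hr
  have hmain := abs_card_mul_div_sub_one_le (gridBasis n hL0) volume (ρ := Real.sqrt n / L)
    (by positivity) hρ hQc hQb hr0 hρr hball
    (by rw [finrank_euclideanSpace, Fintype.card_fin, ← mul_div_assoc]; exact hr)
  rw [coe_span_gridBasis, volume_real_fundamentalDomain_gridBasis, abs_of_pos hL,
    finrank_euclideanSpace, Fintype.card_fin] at hmain
  have e1 : (Nat.card (Q ∩ scaledGrid n L : Set (EuclideanSpace ℝ (Fin n))) : ℝ) * (L ^ n)⁻¹ /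
      volume.real Q = (Nat.card (Q ∩ scaledGrid n L : Set (EuclideanSpace ℝ (Fin n))) : ℝ) /
        (L ^ n * volume.real Q) := by
    rw [div_eq_mul_inv, div_eq_mul_inv, mul_inv, mul_assoc]
  have e2 : 2 * (n : ℝ) * (Real.sqrt n / L) / r = 2 * n * Real.sqrt n / (r * L) := by
    field_simp
  rw [e1, e2] at hmain
  exact hmain

end Grid

end Literature.Algebra.EuclideanLattices
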